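import Literature.MathematicalPhysics.QuantumFieldTheory.Balaban1983to89.B9WalkLettersBondLeib
import Literature.MathematicalPhysics.QuantumFieldTheory.Balaban1983to89.B9WalkLettersOps
import Literature.MathematicalPhysics.QuantumFieldTheory.Balaban1983to89.B9Thm310WholeDir

/-!
# `Balaban1983to89.B9WalkLettersOps310` — W-b FILE 3 (definitions): THE RECORD `ops310WalkYO` OF THE rows-19 BOND-SECTOR WALK LETTERS (THEOREM 3.10, (3.87) ∕
# (3.100) ∕ (3.105)–(3.107)) AT node00-def-Y's MEMBERS — the `B9Thm310Whole.Ops310 ∕ DirOps310 ∕ DirLetters310 ∕ Sizes310 ∕ WalkReading310` records of the N06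
# certificate INSTANTIATED by the coordinate models of `B9WalkLettersBondLeib`, this lineage's site supports ∕ kernels ∕ sizes (`B9WalkLettersCoordsS ∕ …Kernels ∕ …Ops`)
# and GENERIC cube ∕ (3.105) letters `Oc ∕ Δa ∕ Rf ∕ Rt ∕ SF` (the A-side twin of `B9WalkLettersOpsO`; HOME `pub-ymgap-dag-n06-d/W-b-PLAN.md`)

statement-level skeleton of published theorems with citation tags; proofs where landed; nothing here is a claim about the Yang–Mills mass gap

B9 = T. Bałaban, *Propagators for lattice gauge theories in a background field*, Commun. Math. Phys. **99** (1985) 389–434 [Balaban1985BackgroundPropagators];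
[4] = T. Bałaban, *Propagators and renormalization transformations for lattice gauge theories. II*, Commun. Math. Phys. **96** (1984) 223–250 [Balaban1984PropagatorsII].
THE PRINT.  (3.87) p. 409 `G₀ = Σ_□ h_□G_□h_□` (vector sector: p. 409 l. 3–5 «the operators … G_□(U) satisfy all the inequalities of Theorems 3.1–3.3»); (3.100) p. 413 (Leibniz
rules through `h_□`); (3.105)–(3.107) pp. 414–416 «Δ_aG₀ = I − R», `G = G₀(I − R)⁻¹`, the random-walk expansion; p. 410 l. 14–15 «A propagator G′_□ depends on U restricted to
Ω₀(□) ⊂ □̃⁵»; p. 413 «it is localized in X»; [4] (2.36)–(2.44) pp. 229–230.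
WHY THIS FILE (N06 certificate, dag-n06-d; rows 19).  The head «KESC» (`Summit…N06AtOpsYSectEStKnitRecordKESC`) DISPLAYS the rows-19 letters as FREE DATA
`{ιA AA} 𝔬A : ∀ x, Ops310 (geo9Y x) (bg9YR …) (XBK (TrIdx N) x.toKIdx) (XBK …) (ιA x) (AA x)`, `𝔡A 𝔩A κA rdA`, with the pins `hblkA hblkYA hGcoA hDcoA hDscoA hLcoA h𝔡Ad h𝔡As hGsqOA`
and the static ∕ algebraic binders `hstA hκA hrdA hlocA` + the Leibniz ∕ domination clauses of `h36A'`'s `Identities310₂`.  This file gives THE RECORD the pins describe, field by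
field (every pin then holds by `rfl`), with the cube index `ι := ↥(cubes x.toKIdx.D.toDomains)` (as the site record) and the factor index `A` generic:
* `ops310WalkYO x b B cfg bI GA Oc Δa Rf Rt SF` — `blk = blkY := blkBK bI`, `S = S′ := SblkY x bI` (the SITE supports: def-Y's bond map of record is direction-blind, so a bond
  `b` with `h_□(b₋) ≠ 0` is pinned to `sIK bI (chart b₋) ∈ S_□`), `h = hY := hWalkBY x` (`h_□` read at `b₋`), the five Leibniz kernels `KPD KCD KPL KCL KCLt :=` this lineage's
  SITE kernels `kPDY (= 0) ∕ kCDY ∕ kPLY ∕ kCLY ∕ kCLtY` (✓`B9WalkLettersKernels`; they majorise the bond letters by ✓`B9WalkLettersBondDom`), `G := GcoK … GA`, `Gsq U □ := GcoK … (Oc □) U`,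
  `D ∕ Dstar ∕ Lap := DcoK ∕ DscoK ∕ LcoK`, `PD = PL := 0` (dead: `Identities310₂` reads the direction letters), `CD ∕ CL ∕ CLt := cdcoB ∕ clcoB ∕ cltcoB` at `h := h_□`; the
  U-dependent DESIGN-OPEN fields `Δa` (print's `Δ_a` of (3.27) on the bond carrier), the (3.105) factor families `Rf ∕ Rt` and their localisations `SF` are PARAMETERS exactly as
  `B9WalkLettersOpsO.opsWalkYO` keeps the cube letter `O` (no premature pin: the four laws `inv ∕ invT ∕ eq3105 ∕ eq3105T` stay displayed at the record);
* `dirOps310WalkYO` (`Dd ∕ Dsd := dirDcoB ∕ dirDscoB` — LITERALLY the certificate's `h𝔡Ad ∕ h𝔡As` shapes), `dirLetters310WalkYO` (`PLd := plcoB`, `KPLd := kPLdY`), `kappa310WalkY`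
  (the five Leibniz sizes of `kappaWalkY`), `agree310WalkYO near` (bond variables one step around the sites of `near □`), `rd310WalkYO near AgreeF` (`ev := evBK`);
* §2 the pins by `rfl` (`ops310WalkYO_static ∕ _kernels ∕ _letters`, `dir310WalkYO_letters`, `dirOps310WalkYO_pins` — the certificate's nine pin shapes — `rd310WalkYO_fields`,
  `dirLetters310WalkYO_sum`), `abs_hWalkBY_le_one`, `blkBK_mem_SblkY_of_hWalkBY_ne_zero` (the `hS` clause, from direction-blindness), `mulOp_hWalkBY_eq_mulcoB`.
The laws (`StaticOK310`, `Sizes310.Bounded`, the eleven letter clauses of `Identities310₂`, `WalkReading310.OKRel`, `Locality310`) are W-b FILE 4 (`B9WalkLettersOps310Facts`).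
HONEST SCOPE.  Definitions with bodies + `rfl` ∕ one-line bookkeeping; nothing of [B9] asserted; no regime; count-neutral; N06 NOT discharged; nothing continuum ∕ OS ∕ mass gap ∕
Clay.  Cell `pub-ymgap` (D-0062), node N06 [B9], rows 19, seat `pub-ymgap-dag-n06-d` (g31), 2026-08-31.  Net new unproved facts: 0.  NEW file.
-/

noncomputable section

namespace Literature.MathematicalPhysics.QuantumFieldTheory.Balaban1983to89.B9WalkLettersOps310

open Node00
open Node00.OpsYNablaBridge (chartY compat_blkSK_blkBK)
open B6KLevelCensusIndexV1 (KIdx)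
open B6Cover236MultiLevelBlocks (cubes)
open B6GlobalChartV1 (PV)
open B9Thm310Whole (Ops310 WalkReading310 Sizes310)
open B9Thm310WholeDir (DirLetters310)
open B9RWSums346SecondDiff (DirOps310)
open B9Thm37Sum (mulOp)
open B9Thm37CubeCoverCommutators (hTY one_le_Mh_and_P)
open B6Partition118KLevelTorus (abs_hT_le_one)
open B9PinMembersKLevelV1 (MemberY geo9Y)
open B9CoReadingCoords (XBK blkBK evBK GcoK DcoK DscoK LcoK cdBₗ cdsBₗ coordOpK)
open B9CoReadingCoordsS (XSK blkSK sIK)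
open B9WalkLettersCoordsS (cubeDomY SblkY hWalkY blkSK_mem_SblkY_of_hWalkY_ne_zero)
open B9WalkLettersKernels (kPDY kCDY kPLY kPLdY kCLY kCLtY sum_kPLdY)
open B9WalkLettersOps (kappaWalkY)
open B9WalkLettersBondLeib (mulcoB dirDcoB dirDscoB cdcoB cltcoB plcoB clcoB mulOp_bond_eq_coordOpK)

variable {d ℓ : ℕ} {hd : 1 ≤ d + 1} {hL : Odd (ℓ + 1) ∧ 1 < ℓ + 1} {b₀ b₁ : ℝ} {Mstar : ℕ}
variable {𝔸 : Type} [NormedRing 𝔸] [NormedAlgebra ℂ 𝔸] [CompleteSpace 𝔸] [FiniteDimensional ℝ 𝔸] {κ : Type} [Fintype κ] [DecidableEq κ]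
variable (x : MemberY d ℓ hd hL b₀ b₁ Mstar) (b : Module.Basis κ ℝ 𝔸) (B : B9.Backgrounds) (cfg : B.Cfg → CfgY 𝔸 x.toKIdx)
variable (bI : FBondY x.toKIdx → IBondY x.toKIdx)

/-! ## §1 The record of the bond-sector walk letters -/

/-- **the partition function `h_□` on the bond carrier**, read at the initial point `b₋` of the bond ((3.100): `h(x)` for `b = ⟨x, x + ηe_μ⟩`).
[cite: Balaban1985BackgroundPropagators, p.408 («Σ_□ h_□² = 1»), (3.100) p.413; Balaban1984PropagatorsII, (2.36) p.229] -/
def hWalkBY (c : ↥(cubes x.toKIdx.D.toDomains)) : XBK κ x.toKIdx → ℝ := fun p => hTY x.toKIdx c (chartY x.toKIdx p.1.src)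

variable {A : Type} (GA : BondOpY 𝔸 x.toKIdx) (Oc : ↥(cubes x.toKIdx.D.toDomains) → BondOpY 𝔸 x.toKIdx)
  (Δa : B.Cfg → Module.End ℝ (XBK κ x.toKIdx → ℝ)) (Rf Rt : B.Cfg → A → Module.End ℝ (XBK κ x.toKIdx → ℝ)) (SF : A → Finset (geo9Y x).Site)

/-- ★★★ **THE rows-19 WALK LETTERS OF RECORD WITH GENERIC CUBE ∕ (3.105) LETTERS** `ops310WalkYO x b B cfg bI GA Oc Δa Rf Rt SF`: the `Ops310` record of (3.87) ∕ (3.100) ∕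
(3.105)–(3.107) at a member — blocks `blkBK bI`, supports `SblkY`, partition `hWalkBY`, the five site kernels, `G := GcoK … GA` (the certificate's pin `hGcoA` at def-Y's
`letters.GA`), `Gsq U □ := GcoK … (Oc □) U` (pin `hGsqOA`), `D ∕ Dstar ∕ Lap := DcoK ∕ DscoK ∕ LcoK` (pins `hDcoA hDscoA hLcoA`), the Leibniz letters `CD ∕ CL ∕ CLt := cdcoB ∕
clcoB ∕ cltcoB` at `h := h_□`, dead `PD = PL := 0`; `Δa`, `Rf`, `Rt`, `SF` FREE (print's `Δ_a`, the factor families `R_α(X)` ∕ `R♯_α(X)` of (3.105) and their localisations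
«X ∩ 𝔅», p. 413 — design-open at NODE 00's instance). [cite: Balaban1985BackgroundPropagators, (3.87) p.409, (3.100) p.413, (3.105)–(3.107) pp.414–416; Balaban1984PropagatorsII, (2.36)–(2.44) pp.229–230] -/
def ops310WalkYO : Ops310 (geo9Y x) B (XBK κ x.toKIdx) (XBK κ x.toKIdx) ↥(cubes x.toKIdx.D.toDomains) A where
  blk := blkBK x.toKIdx bI
  blkY := blkBK x.toKIdx bI
  S := SblkY x bI
  S' := SblkY x bI
  SF := SF
  h := hWalkBY x
  hY := hWalkBY x
  KPD := kPDY x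
  KCD := kCDY x b bI
  KPL := kPLY x b bI
  KCL := kCLY x b bI
  KCLt := kCLtY x b bI
  G := fun U => GcoK x.toKIdx b B cfg GA U
  Δa := Δa
  Gsq := fun U c => GcoK x.toKIdx b B cfg (Oc c) U
  Rf := Rf
  Rt := Rt
  D := fun U => DcoK x.toKIdx b B cfg U
  Dstar := fun U => DscoK x.toKIdx b B cfg U
  Lap := fun U => LcoK x.toKIdx b B cfg U
  PD := fun _ _ => 0
  CD := fun U c => cdcoB x.toKIdx b B cfg U (hTY x.toKIdx c)
  PL := fun _ _ => 0
  CL := fun _ c => clcoB x.toKIdx b (hTY x.toKIdx c)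
  CLt := fun U c => cltcoB x.toKIdx b B cfg U (hTY x.toKIdx c)

/-- ★ **THE DIRECTION OPERATORS OF RECORD** (`∇_{U,μ} ∕ ∇*_{U,μ}` on the bond carrier — the certificate's `h𝔡Ad ∕ h𝔡As` shapes `coordOpK b (fun _ => cdBₗ U μ)`).
[cite: Balaban1985BackgroundPropagators, (3.3) p.390, (3.8) p.392, (3.42) p.397] -/
def dirOps310WalkYO : DirOps310 (ops310WalkYO x b B cfg bI GA Oc Δa Rf Rt SF) (Fin (d + 1)) where
  Dd := fun U μ => dirDcoB x.toKIdx b B cfg U μ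
  Dsd := fun U μ => dirDscoB x.toKIdx b B cfg U μ

/-- ★ **THE DIRECTION LETTERS OF RECORD** (`P^L_□,μ := plcoB` at `h := h_□` with the per-direction site kernels `kPLdY`).
[cite: Balaban1985BackgroundPropagators, (3.88) p.409, (3.100) p.413; Balaban1984PropagatorsII, (2.39)–(2.40) pp.229–230] -/
def dirLetters310WalkYO : DirLetters310 (ops310WalkYO x b B cfg bI GA Oc Δa Rf Rt SF) (Fin (d + 1)) where
  PLd := fun U c μ => plcoB x.toKIdx b B cfg U (hTY x.toKIdx c) μ
  KPLd := kPLdY x b bI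

/-- ★ **THE LEIBNIZ SIZES OF RECORD** `κA(x)`: the five Leibniz entries of this lineage's `kappaWalkY x b` (explicit member-uniform numerators times `M_h⁻¹` ∕ `M_h⁻²`; `kPD = 0`).
[cite: Balaban1985BackgroundPropagators, (3.100) p.413; Balaban1984PropagatorsII, (2.44) p.230] -/
def kappa310WalkY : Sizes310 where
  kPD := (kappaWalkY x b).kPD
  kCD := (kappaWalkY x b).kCD
  kPL := (kappaWalkY x b).kPL
  kCL := (kappaWalkY x b).kCL
  kCLt := (kappaWalkY x b).kCLt

/-- ★ **THE AGREEMENT PREDICATE OF THE BOND-SECTOR READING** with a generic reading domain `near □` (print's «U restricted to Ω₀(□) ⊂ □̃⁵»): the bond variables one step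
around every site of `near □` (forward and backward, every direction) coincide — the bond half of `B9WalkLettersOpsO.agreeWalkYO` (the vector sector has no averaging
transporters in its Leibniz letters). [cite: Balaban1985BackgroundPropagators, p.410 L14–15, (3.3) p.390, (3.100) p.413] -/
def agree310WalkYO (near : ↥(cubes x.toKIdx.D.toDomains) → Finset (SiteY x.toKIdx)) (c : ↥(cubes x.toKIdx.D.toDomains)) (U U' : B.Cfg) : Prop :=
  ∀ z ∈ near c, ∀ μ, UboxY x.toKIdx (cfg U) μ z = UboxY x.toKIdx (cfg U') μ z ∧
    UboxY x.toKIdx (cfg U) μ ((shiftY x.toKIdx μ).symm z) = UboxY x.toKIdx (cfg U') μ ((shiftY x.toKIdx μ).symm z)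

/-- ★ **THE BOND-SECTOR WALK READING OF RECORD**: the evaluation `evBK` of the located test functions on the bond carrier (`B9CoReadingCoords`), the agreement predicate
`agree310WalkYO near` for the head factors, and a GENERIC agreement predicate `AgreeF` for the (generic) factor families (p. 413 «it depends on U restricted to X̃⁵»).
[cite: Balaban1985BackgroundPropagators, (3.39) + (3.42) p.397, p.410 L14–15, p.413] -/
def rd310WalkYO (near : ↥(cubes x.toKIdx.D.toDomains) → Finset (SiteY x.toKIdx)) (AgreeF : A → B.Cfg → B.Cfg → Prop) :
    WalkReading310 (geo9Y x) B (XBK κ x.toKIdx) ↥(cubes x.toKIdx.D.toDomains) A where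
  ev := evBK x.toKIdx
  Agree := agree310WalkYO x B cfg near
  AgreeF := AgreeF

/-! ## §2 The pins, by `rfl`, and the partition's support clause -/

omit [DecidableEq κ] in
/-- the block maps, the support sets, the localisations and the partition of the record (pins `hblkA hblkYA`; `S′ = S`). [cite: Balaban1985BackgroundPropagators, (3.87) p.409, p.413, bookkeeping] -/
theorem ops310WalkYO_static :
    (ops310WalkYO x b B cfg bI GA Oc Δa Rf Rt SF).blk = blkBK x.toKIdx bI ∧ (ops310WalkYO x b B cfg bI GA Oc Δa Rf Rt SF).blkY = blkBK x.toKIdx bI ∧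
    (ops310WalkYO x b B cfg bI GA Oc Δa Rf Rt SF).S = SblkY x bI ∧ (ops310WalkYO x b B cfg bI GA Oc Δa Rf Rt SF).S' = SblkY x bI ∧
    (ops310WalkYO x b B cfg bI GA Oc Δa Rf Rt SF).SF = SF ∧
    (ops310WalkYO x b B cfg bI GA Oc Δa Rf Rt SF).h = hWalkBY x ∧ (ops310WalkYO x b B cfg bI GA Oc Δa Rf Rt SF).hY = hWalkBY x :=
  ⟨rfl, rfl, rfl, rfl, rfl, rfl, rfl⟩

omit [DecidableEq κ] in
/-- the kernels of the record ARE the site kernels of `B9WalkLettersKernels`. [cite: Balaban1985BackgroundPropagators, (3.89) p.409, (3.100) p.413, bookkeeping] -/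
theorem ops310WalkYO_kernels :
    (ops310WalkYO x b B cfg bI GA Oc Δa Rf Rt SF).KPD = kPDY x ∧ (ops310WalkYO x b B cfg bI GA Oc Δa Rf Rt SF).KCD = kCDY x b bI ∧
    (ops310WalkYO x b B cfg bI GA Oc Δa Rf Rt SF).KPL = kPLY x b bI ∧ (ops310WalkYO x b B cfg bI GA Oc Δa Rf Rt SF).KCL = kCLY x b bI ∧
    (ops310WalkYO x b B cfg bI GA Oc Δa Rf Rt SF).KCLt = kCLtY x b bI :=
  ⟨rfl, rfl, rfl, rfl, rfl⟩

omit [DecidableEq κ] in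
/-- ★ the `U`-dependent letters of the record (pins `hGcoA hGsqOA hDcoA hDscoA hLcoA` at `cfg := id`; the Leibniz letters; the dead letters; the free letters).
[cite: Balaban1985BackgroundPropagators, (3.87) p.409, (3.100) p.413, (3.105) p.414, (3.42) p.397, bookkeeping] -/
theorem ops310WalkYO_letters (U : B.Cfg) (c : ↥(cubes x.toKIdx.D.toDomains)) :
    (ops310WalkYO x b B cfg bI GA Oc Δa Rf Rt SF).G U = GcoK x.toKIdx b B cfg GA U ∧
    (ops310WalkYO x b B cfg bI GA Oc Δa Rf Rt SF).Gsq U c = GcoK x.toKIdx b B cfg (Oc c) U ∧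
    (ops310WalkYO x b B cfg bI GA Oc Δa Rf Rt SF).D U = DcoK x.toKIdx b B cfg U ∧ (ops310WalkYO x b B cfg bI GA Oc Δa Rf Rt SF).Dstar U = DscoK x.toKIdx b B cfg U ∧
    (ops310WalkYO x b B cfg bI GA Oc Δa Rf Rt SF).Lap U = LcoK x.toKIdx b B cfg U ∧
    (ops310WalkYO x b B cfg bI GA Oc Δa Rf Rt SF).CD U c = cdcoB x.toKIdx b B cfg U (hTY x.toKIdx c) ∧
    (ops310WalkYO x b B cfg bI GA Oc Δa Rf Rt SF).CL U c = clcoB x.toKIdx b (hTY x.toKIdx c) ∧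
    (ops310WalkYO x b B cfg bI GA Oc Δa Rf Rt SF).CLt U c = cltcoB x.toKIdx b B cfg U (hTY x.toKIdx c) ∧
    (ops310WalkYO x b B cfg bI GA Oc Δa Rf Rt SF).PD U c = 0 ∧ (ops310WalkYO x b B cfg bI GA Oc Δa Rf Rt SF).PL U c = 0 ∧
    (ops310WalkYO x b B cfg bI GA Oc Δa Rf Rt SF).Δa U = Δa U ∧ (ops310WalkYO x b B cfg bI GA Oc Δa Rf Rt SF).Rf U = Rf U ∧
    (ops310WalkYO x b B cfg bI GA Oc Δa Rf Rt SF).Rt U = Rt U :=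
  ⟨rfl, rfl, rfl, rfl, rfl, rfl, rfl, rfl, rfl, rfl, rfl, rfl, rfl⟩

omit [DecidableEq κ] in
/-- the direction operators and letters of the record. [cite: Balaban1985BackgroundPropagators, (3.3) p.390, (3.8) p.392, (3.88) p.409, bookkeeping] -/
theorem dir310WalkYO_letters (U : B.Cfg) (c : ↥(cubes x.toKIdx.D.toDomains)) (μ : Fin (d + 1)) :
    (dirOps310WalkYO x b B cfg bI GA Oc Δa Rf Rt SF).Dd U μ = dirDcoB x.toKIdx b B cfg U μ ∧
    (dirOps310WalkYO x b B cfg bI GA Oc Δa Rf Rt SF).Dsd U μ = dirDscoB x.toKIdx b B cfg U μ ∧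
    (dirLetters310WalkYO x b B cfg bI GA Oc Δa Rf Rt SF).PLd U c μ = plcoB x.toKIdx b B cfg U (hTY x.toKIdx c) μ ∧
    (dirLetters310WalkYO x b B cfg bI GA Oc Δa Rf Rt SF).KPLd c μ = kPLdY x b bI c μ :=
  ⟨rfl, rfl, rfl, rfl⟩

omit [DecidableEq κ] in
/-- ★ the certificate's LITERAL pin shapes `h𝔡Ad ∕ h𝔡As`: `Dd U = fun μ => coordOpK b (fun _ => cdBₗ (cfg U) μ)`, `Dsd U = fun μ => coordOpK b (fun _ => cdsBₗ (cfg U) μ)`.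
[cite: Balaban1985BackgroundPropagators, (3.3) p.390, (3.8) p.392, bookkeeping] -/
theorem dirOps310WalkYO_pins (U : B.Cfg) :
    (dirOps310WalkYO x b B cfg bI GA Oc Δa Rf Rt SF).Dd U = (fun μ => coordOpK b (fun _ : Fin (d + 1) => cdBₗ x.toKIdx (cfg U) μ)) ∧
    (dirOps310WalkYO x b B cfg bI GA Oc Δa Rf Rt SF).Dsd U = (fun μ => coordOpK b (fun _ : Fin (d + 1) => cdsBₗ x.toKIdx (cfg U) μ)) :=
  ⟨rfl, rfl⟩

omit [FiniteDimensional ℝ 𝔸] [Fintype κ] in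
/-- the bond reading's fields. [cite: Balaban1985BackgroundPropagators, p.410 L14–15, p.413, bookkeeping] -/
theorem rd310WalkYO_fields (near : ↥(cubes x.toKIdx.D.toDomains) → Finset (SiteY x.toKIdx)) (AgreeF : A → B.Cfg → B.Cfg → Prop) :
    (rd310WalkYO x B cfg (κ := κ) near AgreeF).ev = evBK x.toKIdx ∧ (rd310WalkYO x B cfg (κ := κ) near AgreeF).Agree = agree310WalkYO x B cfg near ∧
    (rd310WalkYO x B cfg (κ := κ) near AgreeF).AgreeF = AgreeF :=
  ⟨rfl, rfl, rfl⟩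

omit [DecidableEq κ] [CompleteSpace 𝔸] in
/-- the sizes of the record are the Leibniz entries of `kappaWalkY`. [cite: Balaban1984PropagatorsII, (2.44) p.230, bookkeeping] -/
theorem kappa310WalkY_fields :
    (kappa310WalkY x b).kPD = (kappaWalkY x b).kPD ∧ (kappa310WalkY x b).kCD = (kappaWalkY x b).kCD ∧ (kappa310WalkY x b).kPL = (kappaWalkY x b).kPL ∧
    (kappa310WalkY x b).kCL = (kappaWalkY x b).kCL ∧ (kappa310WalkY x b).kCLt = (kappaWalkY x b).kCLt :=
  ⟨rfl, rfl, rfl, rfl, rfl⟩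

omit [DecidableEq κ] in
/-- **`Identities310₂.KPLd_sum` AT THE RECORD** (with equality): `Σ_μ KPLd □ μ = KPL □`. [cite: Balaban1985BackgroundPropagators, (3.88) p.409, bookkeeping] -/
theorem dirLetters310WalkYO_sum (c : ↥(cubes x.toKIdx.D.toDomains)) (a y'' : (geo9Y x).Site) :
    (∑ μ, (dirLetters310WalkYO x b B cfg bI GA Oc Δa Rf Rt SF).KPLd c μ a y'') = (ops310WalkYO x b B cfg bI GA Oc Δa Rf Rt SF).KPL c a y'' :=
  sum_kPLdY x b bI c a y''

omit [NormedAlgebra ℂ 𝔸] [CompleteSpace 𝔸] [FiniteDimensional ℝ 𝔸] [Fintype κ] [DecidableEq κ] in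
/-- **`StaticOK310.hh ∕ hhY` AT THE RECORD**: `|h_□| ≤ 1` on the bond carrier. [cite: Balaban1984PropagatorsII, (2.36) p.229; Balaban1985BackgroundPropagators, p.408] -/
theorem abs_hWalkBY_le_one (c : ↥(cubes x.toKIdx.D.toDomains)) (p : XBK κ x.toKIdx) : |hWalkBY x c p| ≤ 1 :=
  abs_hT_le_one x.toKIdx.D (one_le_Mh_and_P x.toKIdx).1 (one_le_Mh_and_P x.toKIdx).2 c _

omit [NormedAlgebra ℂ 𝔸] [CompleteSpace 𝔸] [FiniteDimensional ℝ 𝔸] [Fintype κ] [DecidableEq κ] in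
/-- ★ **`StaticOK310.hS ∕ hSY` AT THE RECORD**: a bond where `h_□` does not vanish is pinned INTO `S_□ = SblkY x bI □` — for a DIRECTION-BLIND bond map (`bI ⟨z, μ⟩ = bI ⟨z, e₀⟩`,
a LAW of def-Y's `bIOfRecord`): `blkBK bI b = sIK bI (chart b₋)` (def-Y `compat_blkSK_blkBK`) and the site clause `blkSK_mem_SblkY_of_hWalkY_ne_zero`.
[cite: Balaban1984PropagatorsII, (2.36) p.229, (2.45) p.231 + p.248 («sites replaced by bonds»); Balaban1985BackgroundPropagators, p.408] -/
theorem blkBK_mem_SblkY_of_hWalkBY_ne_zero (hbI0 : ∀ (z : Site (PV d ℓ x.m x.K hd hL) 0) (μ : Fin (d + 1)), bI ⟨z, μ⟩ = bI ⟨z, 0⟩)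
    (c : ↥(cubes x.toKIdx.D.toDomains)) {p : XBK κ x.toKIdx} (hp : hWalkBY x c p ≠ 0) : blkBK x.toKIdx bI p ∈ SblkY x bI c := by
  obtain ⟨⟨z, μ⟩, ν, a, a'⟩ := p
  rw [← compat_blkSK_blkBK x.toKIdx hbI0 z μ ν ν a a']
  exact blkSK_mem_SblkY_of_hWalkY_ne_zero x bI c (p := (chartY x.toKIdx z, ν, a, a')) hp

omit [DecidableEq κ] [CompleteSpace 𝔸] [FiniteDimensional ℝ 𝔸] in
/-- ★ **THE REAL CUT-OFF `M_{h_□}` ON THE BOND CARRIER IS THE COORDINATE MODEL `mulcoB (h_□)`** (`B9WalkLettersBondLeib.mulOp_bond_eq_coordOpK` at `w := hTY □`) — the bridge from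
`Identities310₂`'s `mulOp (𝔬.h □)` to the Leibniz theorems of `B9WalkLettersBondLeib`. [cite: Balaban1985BackgroundPropagators, (3.87) p.409, (3.100) p.413, dictionary] -/
theorem mulOp_hWalkBY_eq_mulcoB (c : ↥(cubes x.toKIdx.D.toDomains)) : mulOp (hWalkBY (κ := κ) x c) = mulcoB (𝔸 := 𝔸) x.toKIdx b (hTY x.toKIdx c) :=
  mulOp_bond_eq_coordOpK x.toKIdx b (hTY x.toKIdx c)

end Literature.MathematicalPhysics.QuantumFieldTheory.Balaban1983to89.B9WalkLettersOps310

end
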